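/-
Origin: expansion seat `prover-pub-hodgecm-mc-binder-2-g7-0`, handover #12 18:58Z md5 1fc65d500431 (167 l.; imports #7 + the three twins above — INSTALL AFTER them, DROP-ONLY-THIS-ROW otherwise; (J-ins)↔(J-smooth)/(J-omg) bridge: `cmPlaceIdxAt v : Fin n ≃ DPIdx P' Q' R' S'`, `cmSplitIdxAt v` (+ `_apply_same` / `_apply_of_ne`), `cmBlockFrameAt_follandFock` (`F (follandFock cmBigFrame G) = binvPi (rename (cmSplitIdxAt v) G)`), `rename_cmSplitIdxAt_prod_atPlace`, HEADLINE `cmBlockFrameAt_follandFock_prod_atPlace` (`F (follandFock cmBigFrame (∏_w P_w(z_{·,w}))) = binvPi (rename (cmPlaceIdxAt v) (P v)) ⊠ binvPi (∏_{w ≠ v} …)`) and `follandFock_prod_atPlace_eq_symm_tensorPi` (the printed pure tensor of `InsRaw` with frame `cmBigFrame` IS the `Ψ = F⁻¹(Φ₁ ⊠ Φ₂)` of #7/#9); farm amalgam (tree leaf inlined) rc 0 / 0 warn; axioms trio) (`HOME/mc/pub-hodgecm-mc-binder-2/g7/pkg/HodgeCM/Model/HypCensus/InsBlock.lean`, md5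 1fc65d50, 167 lines);
landed by the gen-13 packager (p-g13) in gate run 37 as `HodgeCM/Model/HypCensus/InsBlock.lean` (verbatim).
-/
/-
Origin: speedrun cell pub-hodgecm, MODEL-CONSTRUCTION sub-cell, lineage mc-binder-2 (rows A12/A34 of the binder ledger:
`hyp12` / `hyp34`), seat prover-pub-hodgecm-mc-binder-2-g7-0 (gen 7), 2026-08-19.  Target in PKG:
`HodgeCM/Model/HypCensus/InsBlock.lean` (NEW additive leaf; imports this lineage's `SmoothTheta` and the K-1 twins of
`Weil1964/ArchFollandCompactKType` (PKG) and of the tree leaf `Analysis/SegalBargmann/SchwartzTensorPiBargmann` (binder-2-g7,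
p193078) — install after that twin).  KERNEL only: 0 records / named facts / proof holes.
-/
import Summits.HodgeConjecture.HodgeCM.Model.HypCensus.SmoothTheta
import Literature.NumberTheory.Weil1964.ArchFollandCompactKType
import Literature.Analysis.SegalBargmann.SchwartzTensorPiBargmann
import Literature.Analysis.SegalBargmann.FockPlaceSubstitution

/-!
# Census kit (rows A12/A34), junction (J-ins) ↔ (J-smooth)/(J-omg): the printed insertion READ IN THE BLOCK FRAME of a place

The printed insertion of the census (`HypCensus/InsRaw`, kit #4) sends a pure tensor of local Fock polynomials `⊗_w P_w` to the
adelic Schwartz function `E(follandFock 𝔢 (∏_w P_w(z_{·,w})) ⊗ Φ_f)`, `𝔢` a real frame of `(L⁺ ⊗ ℝ)^n`.  The block statements of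
this kit (`SmoothBlock`, `SmoothTheta`, `TorusBlock`) speak of vectors `F⁻¹(Φ₁ ⊠ Φ₂)`, `F = cmBlockFrameAt v` the block frame at ONE
real place `v`.  With the frame of record `𝔢 := cmBigFrame` (weil-2's scaled Folland frame, the first factor of `cmBlockFrameAt`)
the two currencies AGREE on the nose:

* §1 the index bookkeeping at `v`: `cmPlaceIdxAt v : Fin n ≃ DPIdx P' Q' R' S'` (pair frame ≫ relabel) and
  `cmSplitIdxAt v : Fin n × {places} ≃ DPIdx P' Q' R' S' ⊕ (Fin n × {w ≠ v})` (= `(cmBlockSplitAt v)⁻¹ ≫ (cmBlockRelabelAt v)⁻¹`),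
  with `cmSplitIdxAt_apply_same : (i, v) ↦ inl (cmPlaceIdxAt v i)` and `cmSplitIdxAt_apply_of_ne : (i, w) ↦ inr (i, w)`;
* §2 **`cmBlockFrameAt_follandFock`**: `F (follandFock cmBigFrame G) = binvPi (rename (cmSplitIdxAt v) G)` for EVERY polynomial `G`
  in the variables `Fin n × {places}` (tree `schwartzTransport_follandFock` + `schwartzTransport_relabelCLE_binvPi`);
* §3 **`rename_cmSplitIdxAt_prod_atPlace`** (combinatorics): a place product `∏_w P_w(z_{·,w})` read through `cmSplitIdxAt v` is
  `P_v(z_inl ∘ cmPlaceIdxAt v) · ∏_{w ≠ v} P_w(z_inr,(·,w))`, and the HEADLINE **`cmBlockFrameAt_follandFock_prod_atPlace`**: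
  `F (follandFock cmBigFrame (∏_w P_w(z_{·,w}))) = binvPi (rename (cmPlaceIdxAt v) P_v) ⊠ binvPi (∏_{w ≠ v} P_w(z_{(·,w)}))`
  (my tree leaf `binvPi_rename_mul`, [Folland1989, §1.6–1.7]) — i.e. the printed pure tensor IS `F⁻¹(Φ₁ ⊠ Φ₂)` with
  `Φ₁ = binvPi (P_v relabelled)` and `Φ₂` the Bargmann inverse of the other places' product, the shape consumed by
  `tendsto_toThetaTop_cmPairRepTwist_one_hypV_sub_div` (#7) and `exists_vacExponents_cmArchWeilRep_κ` (#9).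

Nothing here is a claim of PerL/QW8.  Style lint (L-notation): no `local notation`.
-/

set_option autoImplicit false

noncomputable section

open Filter Topology MvPolynomial
open NumberField NumberField.InfinitePlace IsDedekindDomain MeasureTheory
open scoped Matrix
open scoped Kronecker Classical TensorProduct ComplexConjugate
open Literature.NumberTheory.Automorphic Literature.NumberTheory.Automorphic.UnitaryGroup Literature.NumberTheory.Weil1964
open Literature.RepresentationTheory.HeisenbergGroup (polar Heisenberg symplecticGroup ofSymplectic)
open Literature.RepresentationTheory.KonnoKonno2007 Literature.RepresentationTheory.KonnoKonno2007.RealDualPair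
open Literature.NumberTheory.GelbartRogawski1991 Literature.NumberTheory.GelbartRogawski1991.UnitaryDualPair
open Literature.Analysis.SegalBargmann Literature.Analysis.Distribution
open Literature.RepresentationTheory (atPlace)

namespace HodgeCM.Model.HypCensus

section CMPinIns

variable (L : Type) [Field L] [NumberField L] [IsCMField L] {N M n : ℕ} (e : Fin N × Fin M ≃ Fin n)
variable (dV : Fin N → L) (hdV : ∀ i, IsCMField.complexConj L (dV i) = dV i) (hdV0 : ∀ i, dV i ≠ 0)
variable (dW : Fin M → L) (hdW : ∀ i, IsCMField.complexConj L (dW i) = dW i) (hdW0 : ∀ i, dW i ≠ 0)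
variable (ι₁ : L →+* ℂ)
variable (v : {v : InfinitePlace ↥(maximalRealSubfield L) // v.IsReal})
variable {P' Q' R' S' : Type} [Fintype P'] [DecidableEq P'] [Fintype Q'] [DecidableEq Q'] [Fintype R'] [DecidableEq R']
  [Fintype S'] [DecidableEq S']
variable (eP : PosIdx (cmXV L dV hdV ι₁ v) ≃ P') (eQ : NegIdx (cmXV L dV hdV ι₁ v) ≃ Q')
  (eR : PosIdx (cmXW L dV dW hdW ι₁ v) ≃ R') (eS : NegIdx (cmXW L dV dW hdW ι₁ v) ≃ S')

/-! ## §1 Index bookkeeping at the place `v` -/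

/-- **the coordinates of the place `v` read in Konno–Konno's block index**: pair frame, then the four-fold relabelling. -/
abbrev cmPlaceIdxAt : Fin n ≃ DPIdx P' Q' R' S' :=
  (pairFrame (PosIdx (cmXV L dV hdV ι₁ v)) (NegIdx (cmXV L dV hdV ι₁ v)) (PosIdx (cmXW L dV dW hdW ι₁ v))
      (NegIdx (cmXW L dV dW hdW ι₁ v)) e (cmEpsV L dV hdV ι₁ v) (cmEpsW L dV dW hdW ι₁ v)).trans
    (dpIdxCongr (PosIdx (cmXV L dV hdV ι₁ v)) (NegIdx (cmXV L dV hdV ι₁ v)) (PosIdx (cmXW L dV dW hdW ι₁ v))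
      (NegIdx (cmXW L dV dW hdW ι₁ v)) P' Q' R' S' eP eQ eR eS)

/-- **the global index split at `v`**: `(cmBlockSplitAt v)⁻¹` followed by `(cmBlockRelabelAt v)⁻¹`. -/
abbrev cmSplitIdxAt :
    Fin n × {w : InfinitePlace ↥(maximalRealSubfield L) // w.IsReal} ≃
      DPIdx P' Q' R' S' ⊕ (Fin n × {w : {w : InfinitePlace ↥(maximalRealSubfield L) // w.IsReal} // w ≠ v}) :=
  (cmBlockSplitAt L e dV hdV dW hdW ι₁ v).symm.trans (cmBlockRelabelAt L dV hdV dW hdW ι₁ v eP eQ eR eS).symm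

omit [Fintype P'] [DecidableEq P'] [Fintype Q'] [DecidableEq Q'] [Fintype R'] [DecidableEq R'] [Fintype S'] [DecidableEq S'] in
/-- on the slice `v`: `(i, v) ↦ inl (cmPlaceIdxAt v i)`. -/
theorem cmSplitIdxAt_apply_same (i : Fin n) :
    cmSplitIdxAt L e dV hdV dW hdW ι₁ v eP eQ eR eS (i, v) = Sum.inl (cmPlaceIdxAt L e dV hdV dW hdW ι₁ v eP eQ eR eS i) := by
  rw [Equiv.trans_apply, placeSplitEquiv_symm_apply_same]
  rfl

omit [Fintype P'] [DecidableEq P'] [Fintype Q'] [DecidableEq Q'] [Fintype R'] [DecidableEq R'] [Fintype S'] [DecidableEq S'] in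
/-- off the slice: `(i, w) ↦ inr (i, w)`. -/
theorem cmSplitIdxAt_apply_of_ne (i : Fin n) {w : {w : InfinitePlace ↥(maximalRealSubfield L) // w.IsReal}} (hw : w ≠ v) :
    cmSplitIdxAt L e dV hdV dW hdW ι₁ v eP eQ eR eS (i, w) = Sum.inr (i, ⟨w, hw⟩) := by
  rw [Equiv.trans_apply, placeSplitEquiv_symm_apply_of_ne _ _ _ hw]
  rfl

/-! ## §2 The block frame on Folland–Fock vectors -/

omit [DecidableEq P'] [DecidableEq Q'] [DecidableEq R'] [DecidableEq S'] in
/-- **`F (follandFock cmBigFrame G) = binvPi (G read through cmSplitIdxAt v)`** for every polynomial `G` in the variables of all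
places. [Folland1989, §1.7; Weil1964, Chap. I n° 12] -/
theorem cmBlockFrameAt_follandFock
    (G : MvPolynomial (Fin n × {w : InfinitePlace ↥(maximalRealSubfield L) // w.IsReal}) ℂ) :
    cmBlockFrameAt L e dV hdV hdV0 dW hdW hdW0 ι₁ v eP eQ eR eS
        (follandFock (cmBigFrame L e dV hdV hdV0 dW hdW hdW0 ι₁) G) =
      binvPi (rename (cmSplitIdxAt L e dV hdV dW hdW ι₁ v eP eQ eR eS) G) := by
  rw [ContinuousLinearEquiv.trans_apply, ContinuousLinearEquiv.trans_apply, schwartzTransport_follandFock]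
  -- `reindexCLE E = relabelCLE E⁻¹` (definitional), then the Bargmann dictionary under relabelling, twice
  rw [show schwartzTransport (reindexCLE (cmBlockSplitAt L e dV hdV dW hdW ι₁ v)) (binvPi G) =
      binvPi (rename (cmBlockSplitAt L e dV hdV dW hdW ι₁ v).symm G) from
    schwartzTransport_relabelCLE_binvPi (cmBlockSplitAt L e dV hdV dW hdW ι₁ v).symm G,
    show schwartzTransport (reindexCLE (cmBlockRelabelAt L dV hdV dW hdW ι₁ v eP eQ eR eS))
        (binvPi (rename (cmBlockSplitAt L e dV hdV dW hdW ι₁ v).symm G)) =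
      binvPi (rename (cmBlockRelabelAt L dV hdV dW hdW ι₁ v eP eQ eR eS).symm
        (rename (cmBlockSplitAt L e dV hdV dW hdW ι₁ v).symm G)) from
    schwartzTransport_relabelCLE_binvPi (cmBlockRelabelAt L dV hdV dW hdW ι₁ v eP eQ eR eS).symm _,
    rename_rename]
  rfl

/-! ## §3 Place products read through the split: the printed pure tensor is `Φ₁ ⊠ Φ₂` -/

omit [Fintype P'] [DecidableEq P'] [Fintype Q'] [DecidableEq Q'] [Fintype R'] [DecidableEq R'] [Fintype S'] [DecidableEq S'] in
/-- **a place product read through `cmSplitIdxAt v`** splits as the `v`-factor in the first variables times the other places in the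
second. [folklore] -/
theorem rename_cmSplitIdxAt_prod_atPlace
    (P : {w : InfinitePlace ↥(maximalRealSubfield L) // w.IsReal} → MvPolynomial (Fin n) ℂ) :
    rename (cmSplitIdxAt L e dV hdV dW hdW ι₁ v eP eQ eR eS) (∏ w, rename (atPlace w) (P w)) =
      rename Sum.inl (rename (cmPlaceIdxAt L e dV hdV dW hdW ι₁ v eP eQ eR eS) (P v)) *
        rename Sum.inr (∏ w' : {w : {w : InfinitePlace ↥(maximalRealSubfield L) // w.IsReal} // w ≠ v},
          rename (atPlace w') (P w'.1)) := by
  rw [map_prod, ← Finset.mul_prod_erase Finset.univ _ (Finset.mem_univ v), rename_rename, rename_rename]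
  congr 1
  · exact congrArg (fun f => rename f (P v)) (funext fun i => cmSplitIdxAt_apply_same L e dV hdV dW hdW ι₁ v eP eQ eR eS i)
  · rw [map_prod, Finset.prod_subtype (Finset.univ.erase v) (p := fun w => w ≠ v)
      (fun w => by rw [Finset.mem_erase, and_iff_left (Finset.mem_univ w)])]
    refine Finset.prod_congr rfl fun w' _ => ?_
    rw [rename_rename, rename_rename]
    exact congrArg (fun f => rename f (P w'.1))
      (funext fun i => cmSplitIdxAt_apply_of_ne L e dV hdV dW hdW ι₁ v eP eQ eR eS i w'.2)

/-- **HEADLINE — the printed pure tensor in the block frame of `v` is `Φ₁ ⊠ Φ₂`**: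
`F (follandFock cmBigFrame (∏_w P_w(z_{·,w}))) = binvPi (P_v ∘ cmPlaceIdxAt v) ⊠ binvPi (∏_{w ≠ v} P_w(z_{(·,w)}))`.
[Folland1989, §1.6 (1.63)–(1.68), §1.7] -/
theorem cmBlockFrameAt_follandFock_prod_atPlace
    (P : {w : InfinitePlace ↥(maximalRealSubfield L) // w.IsReal} → MvPolynomial (Fin n) ℂ) :
    cmBlockFrameAt L e dV hdV hdV0 dW hdW hdW0 ι₁ v eP eQ eR eS
        (follandFock (cmBigFrame L e dV hdV hdV0 dW hdW hdW0 ι₁) (∏ w, rename (atPlace w) (P w))) =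
      tensorPi (binvPi (rename (cmPlaceIdxAt L e dV hdV dW hdW ι₁ v eP eQ eR eS) (P v)))
        (binvPi (∏ w' : {w : {w : InfinitePlace ↥(maximalRealSubfield L) // w.IsReal} // w ≠ v},
          rename (atPlace w') (P w'.1))) := by
  rw [cmBlockFrameAt_follandFock, rename_cmSplitIdxAt_prod_atPlace]
  convert binvPi_rename_mul _ _ using 2

/-- … equivalently, the printed pure tensor IS `F⁻¹(Φ₁ ⊠ Φ₂)` — the vector `Ψ` of `SmoothTheta` / `TorusBlock`. -/
theorem follandFock_prod_atPlace_eq_symm_tensorPi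
    (P : {w : InfinitePlace ↥(maximalRealSubfield L) // w.IsReal} → MvPolynomial (Fin n) ℂ) :
    follandFock (cmBigFrame L e dV hdV hdV0 dW hdW hdW0 ι₁) (∏ w, rename (atPlace w) (P w)) =
      (cmBlockFrameAt L e dV hdV hdV0 dW hdW hdW0 ι₁ v eP eQ eR eS).symm
        (tensorPi (binvPi (rename (cmPlaceIdxAt L e dV hdV dW hdW ι₁ v eP eQ eR eS) (P v)))
          (binvPi (∏ w' : {w : {w : InfinitePlace ↥(maximalRealSubfield L) // w.IsReal} // w ≠ v},
            rename (atPlace w') (P w'.1)))) := by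
  rw [← cmBlockFrameAt_follandFock_prod_atPlace L e dV hdV hdV0 dW hdW hdW0 ι₁ v eP eQ eR eS,
    ContinuousLinearEquiv.symm_apply_apply]

end CMPinIns

end HodgeCM.Model.HypCensus

end
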